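import Summits.BirchSwinnertonDyer.Rank1Residual.Additive.RamifiedOrdinaryLineUnique
import Summits.BirchSwinnertonDyer.BirchSwinnertonDyer.Theorems.EisensteinDepletionAtTwoStarOptBNSFOddIsoTwoAdicHelpers
import Literature.NumberTheory.EllipticCurves.RationalTorsionKernelOfReductionCriterion
import Literature.NumberTheory.EllipticCurves.IsogenyDualProofs
import Summits.BirchSwinnertonDyer.BirchSwinnertonDyer.Theorems.SchneiderFreeAdditiveX3AnticyclotomicSelmerIsogeny
import HarnessLib

set_option linter.dupNamespace false -- `…BirchSwinnertonDyer.BirchSwinnertonDyer…` is the cell's nested layout (D-0017)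
set_option autoImplicit false

/-!
# (ISO-T₁) road K, part 1: Greenberg's `2`-adic line `C_v(E) = ker(E[2^∞] → Ẽ)` is TRANSPORTED by every `ℚ`-isogeny
# between good-ordinary-at-`2` curves (uniqueness of the ramified ordinary line), and the rational-point dictionary

Cell `bsd-2adic` (run/shared/lean/pub/bsd-2adic/), seat `bsd-2adic-tower-1` GEN 37 (SUMMON RC-513/RC-515, director-bsd g20).
THEOREMS ONLY (no definition, no named fact, no instance, no `sorry`); `--supports stmt-BirchSwinnertonDyer-19218` (route
`TwoAdicConverse`, rung S3, item `GoodOrdinaryRankZeroTwoConverse`).  HONEST FRAMING: item 19218 stays OPEN (its crux `OrdLambdaHalfAtTwo`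
is open); nothing here is booked; BSD is not proved by any of this.

WHY.  p749231 (`…TwoAdicConverseEulerCharKernelAtTwoIsogeny`) reduced item 19218 to PRINT {modularity, Kato 17.4@2}, the crux, and the
displayed class-level hypothesis (ISO-T₁)∣(β): «every non-CM globally minimal `E/ℚ`, good ordinary at `2`, is `ℚ`-isogenous to a globally
minimal `E'` no rational `2`-power torsion point of which reduces into the kernel of reduction at `2`».  The sequel
(`…TwoAdicConverseIsoT1OfMazurKenku`) PROVES (ISO-T₁) from Mazur–Kenku (tree fact `mazurKenku_exists_cyclic_isogeny`) by ROAD K: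
consecutive failures of (T₁)@2 along `E, E/C[2], E/C[4], …` produce rational CYCLIC `2ⁿ`-isogenies (kernel `C_v(E)[2ⁿ]`), impossible for
`n = 5`.  The one local input of that road — «an isogeny maps the `2`-adic line onto the `2`-adic line» (classically: isogenies of
good-reduction curves respect formal groups, Néron) — is obtained here WITHOUT Néron models, from the tree's Galois-theoretic
characterisation of the line: `C_v` is the UNIQUE `2`-divisible proper subgroup of `E[2^∞]` with inertia-trivial quotient
(`RamifiedOrdinaryLineUnique.eq_reductionDatum_plus`: inertia acts on `C_v` through `χ₂` with infinite image, trivially on `Ẽ[2^∞]`).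

* §1 `exists_generator_plus`, `eq_zero_or_eq_of_two_nsmul_eq_zero` — `C_v ∩ E[2^k]` is cyclic of order `2^k` on a generator, read on
  `E[2^∞](ℚ̄) = W.geomPrimaryTorsion 2` (X2's `localRed` line, `OrdinaryLineInertiaCyclotomic`); two `2`-torsion multiples of one point.
* §2 `isogenyPrimaryMap_surjective` — an isogeny of elliptic curves is onto `E'[2^∞]` on `E[2^∞]` (`Isogeny.surjective` + Lagrange).
* §3 ★ `map_reductionDatum_plus_eq` — `φ(C_v(E)) = C_v(E')` for every `ℚ`-isogeny `φ : E → E'` of globally minimal curves with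
  `2 ∤ Δ`, `2 ∤ a₂`; `mem_plus_of_isogenyPrimaryMap_mem` — pull-back: if `ker φ ∩ E[2^∞] ⊆ C_v(E)` then `φ⁻¹(C_v(E')) ∩ E[2^∞] = C_v(E)`.
* §4 `mem_plus_of_mem_localKernelOfReduction` — the dictionary: a RATIONAL point of `E` whose image in `E(ℚ̄_v)` lies in
  `W.localKernelOfReduction v` (the currency of (T₁)@2 in p749231) has `v₂(x) < 0` (`not_mem_localKernelOfReduction_of_valuation_le_one`,
  Silverman VII.1.3(b)) hence lies in X2's `C_v` (`DepletionAtTwo.OddIsoTwoAdic.helper_localRed_ratPoint_eq_zero_iff`);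
  `eq_zero_or_eq_of_mem_plus_two_nsmul` — `C_v ∩ E[2] = {0, q}` for any non-zero `2`-torsion `q ∈ C_v`.

References: [GreenbergLNM1716] §2 pp. 62–63, 69–70 (the line `ℱ[p^∞]`, inertia action); [GreenbergVatsal2000] §2 p. 26;
[SilvermanAEC2009] III.4.8–4.12, III.6.1–6.2, VII.1.3(b), VII.2.1–2.2, VIII.§1; [Mazur1978] Thm. 1; [Kenku1982].
-/

noncomputable section

open scoped Classical NumberField

open NumberField IsDedekindDomain Field WeierstrassCurve
  Literature.NumberTheory.EllipticCurves Literature.NumberTheory.EllipticCurves.GreenbergSelmer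
  Literature.NumberTheory.GaloisRepresentations IsDedekindDomain.HeightOneSpectrum
  Summit.BirchSwinnertonDyer.Rank1Residual.X2.GreenbergVatsalReductionDatum
  Summit.BirchSwinnertonDyer.Rank1Residual.Additive
  Summit.BirchSwinnertonDyer.Rank1Residual.GaloisImage.OrdinaryLineInertiaCyclotomic
  Summit.BirchSwinnertonDyer.BirchSwinnertonDyer.Theorems.SchneiderFree

namespace Summit.BirchSwinnertonDyer.BirchSwinnertonDyer.Theorems.TwoAdicEulerCharKernel.IsoT1

/-! ## §1 The `2`-adic line on `E[2^∞](ℚ̄)`: cyclic layers on a generator -/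

section Line

variable (W : WeierstrassCurve ℚ) [W.IsGloballyMinimal] [W.IsElliptic] {v : HeightOneSpectrum (𝓞 ℚ)}
  (hv : ((2 : ℕ) : 𝓞 ℚ) ∈ v.asIdeal) (hΔ : ¬ (2 : ℤ) ∣ minimalDiscriminantInt W) (hord : ¬ (2 : ℤ) ∣ W.frobeniusTrace 2)

include hord in
/-- **`C_v ∩ E[2^k]` is cyclic of order `2^k` on a generator, on `E[2^∞](ℚ̄)`.**  For a globally minimal `E/ℚ` with `2 ∤ Δ_E`,
`2 ∤ a₂` and the place `v ∋ 2`: there is `g ∈ C_v` of order exactly `2^k` of which every `m ∈ C_v` with `2^k m = 0` is a multiple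
(the local statement `OrdinaryLineInertiaCyclotomic.exists_generator_and_inertia_smul_eq_one_add` on `E(ℚ̄_v)`, pulled back along
the injective `E(ℚ̄) → E(ℚ̄_v)`: torsion points are algebraic, `exists_pointsMapOfEmb_eq_of_nsmul_eq_zero`).
[cite: GreenbergLNM1716, §1 p. 62 (ℱ[p^∞] ≅ ℚ_p/ℤ_p)] [cite: SilvermanAEC2009, Prop. VII.2.1–2.2] -/
theorem exists_generator_plus (k : ℕ) :
    ∃ g : W.geomPrimaryTorsion 2, g ∈ (reductionDatum W 2 hv hΔ).plus ∧ addOrderOf g = 2 ^ k ∧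
      ∀ m ∈ (reductionDatum W 2 hv hΔ).plus, 2 ^ k • m = 0 → ∃ j : ℕ, m = j • g := by
  obtain ⟨P, hPred, hPord, hPgen, -, -⟩ := exists_generator_and_inertia_smul_eq_one_add W 2 hv hΔ hord k
  have hPk : (2 ^ k) • P = 0 := by rw [← hPord]; exact addOrderOf_nsmul_eq_zero P
  obtain ⟨P₀, hP₀k, hP₀⟩ := exists_pointsMapOfEmb_eq_of_nsmul_eq_zero W (closureEmb (K := ℚ) (v.adicCompletion ℚ))
    (m := 2 ^ k) (pow_ne_zero _ two_ne_zero) hPk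
  have hP₀' : pointsMap W (v.adicCompletion ℚ) P₀ = P := hP₀
  set g : W.geomPrimaryTorsion 2 := ⟨P₀, (AddCommGroup.mem_primaryComponent).mpr ⟨k, hP₀k⟩⟩ with hg
  have hgP : pointsMap W (v.adicCompletion ℚ) (g : W.geomPoints) = P := hP₀'
  have hinj := Summit.BirchSwinnertonDyer.Rank1Residual.X2.GreenbergVatsalTateDatumCofree.pointsMap_coe_injective W 2 (v := v)
  refine ⟨g, ?_, ?_, fun m hm hmk ↦ ?_⟩
  · rw [mem_reductionDatum_plus_iff, hgP]; exact hPred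
  · have h1 : addOrderOf P = addOrderOf g := by
      rw [← hgP]
      exact addOrderOf_injective ((pointsMap W (v.adicCompletion ℚ)).comp (W.geomPrimaryTorsion 2).subtype) hinj g
    rw [← h1, hPord]
  · have hmred := (mem_reductionDatum_plus_iff W 2 hv hΔ m).mp hm
    have hmk' : ((2 ^ k : ℕ) : ℤ) • pointsMap W (v.adicCompletion ℚ) (m : W.geomPoints) = 0 := by
      rw [natCast_zsmul, ← map_nsmul, ← AddSubgroupClass.coe_nsmul, hmk, ZeroMemClass.coe_zero, map_zero]
    obtain ⟨j, hj⟩ := hPgen _ hmred hmk'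
    refine ⟨j, hinj ?_⟩
    change pointsMap W (v.adicCompletion ℚ) (m : W.geomPoints) = pointsMap W (v.adicCompletion ℚ) ((j • g : W.geomPrimaryTorsion 2) : W.geomPoints)
    rw [hj, AddSubgroupClass.coe_nsmul, map_nsmul, hgP]

omit [W.IsGloballyMinimal] [W.IsElliptic] in
/-- Two `2`-torsion multiples of one point of `2`-power order coincide or one of them vanishes (the `2`-torsion of a cyclic `2`-group
has at most two elements). [folklore] -/
theorem eq_zero_or_eq_of_two_nsmul_eq_zero {A : Type*} [AddCommGroup A] {z : A} {n : ℕ} (hz : 2 ^ n • z = 0) (i j : ℕ)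
    (hi : 2 • (i • z) = 0) (hj : 2 • (j • z) = 0) : i • z = 0 ∨ j • z = 0 ∨ i • z = j • z := by
  -- the order of `z` is `2^e`
  obtain ⟨e, -, he⟩ := (Nat.dvd_prime_pow Nat.prime_two).mp (addOrderOf_dvd_of_nsmul_eq_zero hz)
  rcases Nat.eq_zero_or_pos e with rfl | hepos
  · rw [pow_zero, AddMonoid.addOrderOf_eq_one_iff] at he
    left; rw [he, smul_zero]
  · -- `w = 2^(e-1) z` has `2 w = 0`, and every `2`-torsion multiple of `z` is `0` or `w`
    obtain ⟨e', rfl⟩ : ∃ e', e = e' + 1 := ⟨e - 1, by omega⟩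
    have key : ∀ i : ℕ, 2 • (i • z) = 0 → i • z = 0 ∨ i • z = 2 ^ e' • z := by
      intro i hi2
      have hdvd : addOrderOf z ∣ 2 * i := by
        apply addOrderOf_dvd_of_nsmul_eq_zero; rw [mul_comm, mul_nsmul]; rwa [two_nsmul, ← two_nsmul] at hi2
      rw [he, pow_succ, mul_comm] at hdvd
      obtain ⟨t, ht⟩ := Nat.dvd_of_mul_dvd_mul_left two_pos hdvd
      rcases Nat.even_or_odd t with ⟨s, rfl⟩ | ⟨s, rfl⟩
      · left
        rw [ht, show 2 ^ e' * (s + s) = (2 ^ e' * 2) * s by ring, mul_nsmul, ← pow_succ, ← he, addOrderOf_nsmul_eq_zero, smul_zero]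
      · right
        rw [ht, show 2 ^ e' * (2 * s + 1) = (2 ^ e' * 2) * s + 2 ^ e' by ring, add_nsmul, mul_nsmul, ← pow_succ, ← he,
          addOrderOf_nsmul_eq_zero, smul_zero, zero_add]
    rcases key i hi with h | h
    · exact Or.inl h
    · rcases key j hj with h' | h'
      · exact Or.inr (Or.inl h')
      · exact Or.inr (Or.inr (h.trans h'.symm))

include hord in
/-- **`C_v ∩ E[2] = {0, q}`**: for any non-zero `2`-torsion `q ∈ C_v`, every `2`-torsion element of `C_v` is `0` or `q`
(`#(C_v ∩ E[2^∞][2]) = 2`, `natCard_reductionDatum_plus_inf_torsionBy`). [cite: GreenbergLNM1716, §1 p. 62] -/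
theorem eq_zero_or_eq_of_mem_plus_two_nsmul {q n : W.geomPrimaryTorsion 2} (hq : q ∈ (reductionDatum W 2 hv hΔ).plus)
    (hq2 : 2 • q = 0) (hq0 : q ≠ 0) (hn : n ∈ (reductionDatum W 2 hv hΔ).plus) (hn2 : 2 • n = 0) : n = 0 ∨ n = q := by
  obtain ⟨g, -, hgord, hgen⟩ := exists_generator_plus W hv hΔ hord 1
  obtain ⟨i, rfl⟩ := hgen q hq (by rw [pow_one]; exact hq2)
  obtain ⟨j, rfl⟩ := hgen n hn (by rw [pow_one]; exact hn2)
  have hg2 : 2 ^ 1 • g = 0 := by rw [← hgord]; exact addOrderOf_nsmul_eq_zero g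
  rcases eq_zero_or_eq_of_two_nsmul_eq_zero hg2 j i hn2 hq2 with h | h | h
  · exact Or.inl h
  · exact absurd h hq0
  · exact Or.inr h

end Line

/-! ## §2 An isogeny of elliptic curves is onto on `2`-primary torsion -/

section Surj

variable {W W' : WeierstrassCurve ℚ} [W.IsElliptic] [W'.IsElliptic]

/-- **`φ(E[2^∞]) = E'[2^∞]`** for an isogeny `φ : E → E'` of elliptic curves over `ℚ`: `φ` is onto `E'(ℚ̄)` (`Isogeny.surjective`,
Silverman II.2.3); if `φ P = m'` with `2^t m' = 0` then `2^t P ∈ ker φ` is killed by `d = #ker φ` (Lagrange), so with `d = 2^a d'`,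
`d'` odd, the point `d' P` is `2`-power torsion and `φ(d' P) = d' m'`, and `d'` is invertible on the `2`-group `⟨m'⟩`.
[cite: SilvermanAEC2009, Thm. II.2.3 and Cor. III.4.9] -/
theorem isogenyPrimaryMap_surjective (φ : Isogeny W W') : Function.Surjective (isogenyPrimaryMap (p := 2) φ) := by
  intro m'
  obtain ⟨t, ht⟩ := (AddCommGroup.mem_primaryComponent).mp m'.2
  obtain ⟨P, hP⟩ := φ.surjective (m' : W'.geomPoints)
  -- `2^t P ∈ ker φ`, killed by `d = #ker φ`
  set d := φ.degree with hd
  have hdP : d • (2 ^ t • P) = 0 := by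
    have hmem : 2 ^ t • P ∈ φ.toAddMonoidHom.ker := by
      rw [AddMonoidHom.mem_ker, map_nsmul, Isogeny.coe_toAddMonoidHom, hP, ht]
    have h := addOrderOf_dvd_natCard (⟨_, hmem⟩ : φ.toAddMonoidHom.ker)
    rw [← addOrderOf_injective φ.toAddMonoidHom.ker.subtype Subtype.coe_injective ⟨_, hmem⟩] at h
    exact addOrderOf_dvd_iff_nsmul_eq_zero.mp h
  -- `d = 2^a d'` with `d'` odd
  obtain ⟨a, d', hd'2, hdd⟩ := Nat.exists_eq_two_pow_mul_odd (n := d) φ.degree_pos.ne'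
  -- `Q = d' P` is `2`-power torsion with `φ Q = d' m'`
  have hQt : 2 ^ (t + a) • (d' • P) = 0 := by
    rw [← mul_nsmul', show 2 ^ (t + a) * d' = (2 ^ a * d') * 2 ^ t by ring, ← hdd, mul_nsmul', hdP]
  set Q : W.geomPrimaryTorsion 2 := ⟨d' • P, (AddCommGroup.mem_primaryComponent).mpr ⟨t + a, hQt⟩⟩ with hQ
  have hφQ : isogenyPrimaryMap (p := 2) φ Q = d' • m' := by
    apply Subtype.ext
    rw [coe_isogenyPrimaryMap, AddSubgroupClass.coe_nsmul, ← hP, ← map_nsmul]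
  -- Bézout: `x d' + y 2^(t+a) = 1`, so `m' = x d' m' = φ (x • Q)`
  have hcop : IsCoprime (d' : ℤ) ((2 ^ (t + a) : ℕ) : ℤ) :=
    Nat.isCoprime_iff_coprime.mpr
      (Nat.Coprime.pow_right _ (Nat.coprime_two_right.mpr hd'2))
  obtain ⟨x, y, hxy⟩ := hcop
  refine ⟨x • Q, ?_⟩
  rw [map_zsmul, hφQ]
  have ht' : 2 ^ t • m' = 0 := Subtype.ext (by rw [AddSubgroupClass.coe_nsmul, ht, ZeroMemClass.coe_zero])
  have h2m' : ((2 ^ (t + a) : ℕ) : ℤ) • m' = 0 := by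
    rw [natCast_zsmul, pow_add, mul_nsmul, ht', smul_zero]
  calc x • (d' • m') = x • ((d' : ℤ) • m') + y • (((2 ^ (t + a) : ℕ) : ℤ) • m') := by
        rw [h2m', smul_zero, add_zero, natCast_zsmul]
    _ = (x * (d' : ℤ) + y * ((2 ^ (t + a) : ℕ) : ℤ)) • m' := by rw [add_zsmul, mul_zsmul, mul_zsmul]
    _ = m' := by rw [hxy, one_zsmul]

end Surj

/-! ## §3 Transport of the line along an isogeny -/

section Transport

variable {W W' : WeierstrassCurve ℚ} [W.IsGloballyMinimal] [W.IsElliptic] [W'.IsGloballyMinimal] [W'.IsElliptic]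
  {v : HeightOneSpectrum (𝓞 ℚ)} (hv : ((2 : ℕ) : 𝓞 ℚ) ∈ v.asIdeal)
  (hΔ : ¬ (2 : ℤ) ∣ minimalDiscriminantInt W) (hord : ¬ (2 : ℤ) ∣ W.frobeniusTrace 2)
  (hΔ' : ¬ (2 : ℤ) ∣ minimalDiscriminantInt W') (hord' : ¬ (2 : ℤ) ∣ W'.frobeniusTrace 2)

omit [W.IsGloballyMinimal] [W.IsElliptic] [W'.IsGloballyMinimal] [W'.IsElliptic] in
/-- The `2`-primary part of `ker φ` has exponent dividing `2^a` where `deg φ = #ker φ = 2^a d'`, `d'` odd (Lagrange in `ker φ`).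
[cite: SilvermanAEC2009, Cor. III.4.9] -/
theorem exists_pow_nsmul_eq_zero_of_isogenyPrimaryMap_eq_zero (φ : Isogeny W W') :
    ∃ a : ℕ, ∀ c : W.geomPrimaryTorsion 2, isogenyPrimaryMap (p := 2) φ c = 0 → 2 ^ a • c = 0 := by
  obtain ⟨a, d', hd'odd, hdd⟩ := Nat.exists_eq_two_pow_mul_odd (n := φ.degree) φ.degree_pos.ne'
  refine ⟨a, fun c hc ↦ ?_⟩
  obtain ⟨t, ht⟩ := (AddCommGroup.mem_primaryComponent).mp c.2
  have hmem : (c : W.geomPoints) ∈ φ.toAddMonoidHom.ker := by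
    rw [AddMonoidHom.mem_ker, Isogeny.coe_toAddMonoidHom, ← coe_isogenyPrimaryMap (p := 2), hc, ZeroMemClass.coe_zero]
  have hdc : φ.degree • (c : W.geomPoints) = 0 := by
    have h := addOrderOf_dvd_natCard (⟨_, hmem⟩ : φ.toAddMonoidHom.ker)
    rw [← addOrderOf_injective φ.toAddMonoidHom.ker.subtype Subtype.coe_injective ⟨_, hmem⟩] at h
    exact addOrderOf_dvd_iff_nsmul_eq_zero.mp h
  have h1 : addOrderOf c ∣ 2 ^ t :=
    addOrderOf_dvd_of_nsmul_eq_zero (Subtype.ext (by rw [AddSubgroupClass.coe_nsmul, ht, ZeroMemClass.coe_zero]))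
  have h2 : addOrderOf c ∣ 2 ^ a * d' := by
    rw [← hdd]
    exact addOrderOf_dvd_of_nsmul_eq_zero (Subtype.ext (by rw [AddSubgroupClass.coe_nsmul, hdc, ZeroMemClass.coe_zero]))
  obtain ⟨e, -, he⟩ := (Nat.dvd_prime_pow Nat.prime_two).mp h1
  have h3 : 2 ^ e ∣ 2 ^ a :=
    (Nat.Coprime.pow_left e (Nat.coprime_two_left.mpr hd'odd)).dvd_of_dvd_mul_right (he ▸ h2)
  exact addOrderOf_dvd_iff_nsmul_eq_zero.mp (he ▸ h3)

include hord hord' in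
/-- ★ **An isogeny maps the `2`-adic line ONTO the `2`-adic line: `φ(C_v(E)) = C_v(E')`.**  `E, E'/ℚ` globally minimal with `2 ∤ Δ`,
`2 ∤ a₂` (good ordinary at `2`), `v ∋ 2`, `φ : E → E'` any `ℚ`-isogeny.  Proof: `X = φ(C_v(E)) ≤ E'[2^∞]` is `2`-divisible (image of
the divisible `C_v(E)`, `reductionDatum_divisible`), proper (its `2`-torsion consists of `2`-torsion multiples of ONE point `φ(g)`,
`g` a generator of a layer of `C_v(E)` — at most two of them — while `#E'[2^∞][2] = 4`), and the local inertia group acts trivially on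
`E'[2^∞]/X` (`φ` is onto `E'[2^∞]`, `Γ_ℚ`-equivariant, and inertia acts trivially on `E[2^∞]/C_v(E)`, `reductionDatum_htriv`); by the
UNIQUENESS of such a subgroup (`RamifiedOrdinaryLineUnique.eq_reductionDatum_plus`: inertia acts on `C_v(E')` through `χ₂`,
Greenberg LNM 1716 p. 70, GV p. 26) `X = C_v(E')`.  This is the Galois-theoretic form of «isogenies of good-reduction curves respect the
formal group» (Néron), needing no integral model of `φ`.
[cite: GreenbergLNM1716, §2 pp. 63, 69–70] [cite: GreenbergVatsal2000, §2 p. 26] [cite: SilvermanAEC2009, VII.2.1–2.2, VIII.§1] -/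
theorem map_reductionDatum_plus_eq (φ : Isogeny W W') :
    ((reductionDatum W 2 hv hΔ).plus).map (isogenyPrimaryMap (p := 2) φ) = (reductionDatum W' 2 hv hΔ').plus := by
  set X := ((reductionDatum W 2 hv hΔ).plus).map (isogenyPrimaryMap (p := 2) φ) with hX
  refine RamifiedOrdinaryLineUnique.eq_reductionDatum_plus W' 2 hv hΔ' hord' X ?_ ?_ ?_
  · -- `2`-divisible
    rintro _ ⟨c, hc, rfl⟩
    obtain ⟨c', hc', rfl⟩ := Summit.BirchSwinnertonDyer.Rank1Residual.Additive.reductionDatum_divisible W 2 hv hΔ hord c hc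
    exact ⟨isogenyPrimaryMap (p := 2) φ c', ⟨c', hc', rfl⟩, by rw [map_nsmul]⟩
  · -- proper: the `2`-torsion of `X` has at most two elements, `E'[2^∞][2]` has four
    intro htop
    obtain ⟨a, ha⟩ := exists_pow_nsmul_eq_zero_of_isogenyPrimaryMap_eq_zero φ
    obtain ⟨g, -, hgord, hgen⟩ := exists_generator_plus W hv hΔ hord (a + 1)
    have hz : 2 ^ (a + 1) • isogenyPrimaryMap (p := 2) φ g = 0 := by
      rw [← map_nsmul, ← hgord, addOrderOf_nsmul_eq_zero, map_zero]
    -- every `2`-torsion element of `E'[2^∞] = X` is a multiple of `z = φ g`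
    have hmult : ∀ x : W'.geomPrimaryTorsion 2, 2 • x = 0 → ∃ j : ℕ, x = j • isogenyPrimaryMap (p := 2) φ g := by
      intro x hx
      have hxX : x ∈ X := by rw [htop]; exact AddSubgroup.mem_top x
      obtain ⟨c, hc, rfl⟩ := hxX
      have h2c : 2 ^ (a + 1) • c = 0 := by
        rw [pow_succ, mul_comm, mul_nsmul]
        exact ha _ (by rw [map_nsmul, hx])
      obtain ⟨j, hj⟩ := hgen c hc h2c
      exact ⟨j, by rw [hj, map_nsmul]⟩
    -- hence `t ↦ (t = 0)` is injective on `E'[2^∞][2]`: `#E'[2^∞][2] ≤ 2`, contradicting `= 4`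
    have hle : Nat.card (AddSubgroup.torsionBy (W'.geomPrimaryTorsion 2) ((2 : ℕ) : ℤ)) ≤ Nat.card Bool := by
      refine Nat.card_le_card_of_injective (fun x ↦ decide ((x : W'.geomPrimaryTorsion 2) = 0)) fun x₁ x₂ h12 ↦ ?_
      have h2 : ∀ x : AddSubgroup.torsionBy (W'.geomPrimaryTorsion 2) ((2 : ℕ) : ℤ), 2 • (x : W'.geomPrimaryTorsion 2) = 0 :=
        fun x ↦ AddSubgroup.torsionBy.nsmul_iff.mp x.2
      obtain ⟨j₁, hj₁⟩ := hmult _ (h2 x₁)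
      obtain ⟨j₂, hj₂⟩ := hmult _ (h2 x₂)
      by_cases h₁ : (x₁ : W'.geomPrimaryTorsion 2) = 0 <;> by_cases h₂ : (x₂ : W'.geomPrimaryTorsion 2) = 0
      · exact Subtype.ext (h₁.trans h₂.symm)
      · simp [h₁, h₂] at h12
      · simp [h₁, h₂] at h12
      · rcases eq_zero_or_eq_of_two_nsmul_eq_zero hz j₁ j₂ (hj₁ ▸ h2 x₁) (hj₂ ▸ h2 x₂) with h | h | h
        · exact absurd (hj₁.trans h) h₁
        · exact absurd (hj₂.trans h) h₂
        · exact Subtype.ext (hj₁.trans (h.trans hj₂.symm))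
    rw [Summit.BirchSwinnertonDyer.Rank1Residual.X2.TrivialZeroCorankAlgebra.natCard_torsionBy_geomPrimaryTorsion W' 2,
      Nat.card_eq_fintype_card, Fintype.card_bool] at hle
    omega
  · -- inertia acts trivially on `E'[2^∞]/X`
    refine ⟨1, one_pos, fun σ hσ m' ↦ ?_⟩
    obtain ⟨m, rfl⟩ := isogenyPrimaryMap_surjective φ m'
    rw [pow_one, ← isogenyPrimaryMap_smul, ← map_sub]
    exact ⟨_, reductionDatum_htriv W 2 hv hΔ _ (Subgroup.mem_map_of_mem _ hσ) m, rfl⟩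

include hord hord' in
/-- **Pull-back of the line.**  With `φ(C_v(E)) = C_v(E')`: if the `2`-primary part of `ker φ` lies in `C_v(E)`, then
`m ∈ E[2^∞]` lies in `C_v(E)` as soon as `φ m ∈ C_v(E')`. [cite: GreenbergLNM1716, §2 pp. 63, 69–70] -/
theorem mem_plus_of_isogenyPrimaryMap_mem (φ : Isogeny W W')
    (hker : ∀ c : W.geomPrimaryTorsion 2, isogenyPrimaryMap (p := 2) φ c = 0 → c ∈ (reductionDatum W 2 hv hΔ).plus)
    {m : W.geomPrimaryTorsion 2} (hm : isogenyPrimaryMap (p := 2) φ m ∈ (reductionDatum W' 2 hv hΔ').plus) :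
    m ∈ (reductionDatum W 2 hv hΔ).plus := by
  rw [← map_reductionDatum_plus_eq hv hΔ hord hΔ' hord' φ] at hm
  obtain ⟨c, hc, hcm⟩ := hm
  have h0 : isogenyPrimaryMap (p := 2) φ (m - c) = 0 := by rw [map_sub, hcm, sub_self]
  have h := (reductionDatum W 2 hv hΔ).plus.add_mem (hker _ h0) hc
  rwa [sub_add_cancel] at h

include hord hord' in
/-- **The line goes to the line**: `m ∈ C_v(E) ⟹ φ m ∈ C_v(E')`. [cite: GreenbergLNM1716, §2 pp. 63, 69–70] -/
theorem isogenyPrimaryMap_mem_plus (φ : Isogeny W W') {m : W.geomPrimaryTorsion 2} (hm : m ∈ (reductionDatum W 2 hv hΔ).plus) :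
    isogenyPrimaryMap (p := 2) φ m ∈ (reductionDatum W' 2 hv hΔ').plus := by
  rw [← map_reductionDatum_plus_eq hv hΔ hord hΔ' hord' φ]
  exact ⟨m, hm, rfl⟩

end Transport

/-! ## §4 The dictionary: rational points in the kernel of reduction lie on the line -/

section Dictionary

variable (W : WeierstrassCurve ℚ) [W.IsGloballyMinimal] [W.IsElliptic] {v : HeightOneSpectrum (𝓞 ℚ)}
  (hv : ((2 : ℕ) : 𝓞 ℚ) ∈ v.asIdeal) (hΔ : ¬ (2 : ℤ) ∣ minimalDiscriminantInt W)

/-- **From p749231's currency to X2's line.**  For a globally minimal `E/ℚ` with `2 ∤ Δ_E` and a RATIONAL point `P` whose image in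
`E(ℚ̄_v)` lies in the kernel of reduction `W.localKernelOfReduction v` of the `ℚ_v`-minimal model: `P = (x, y)` with `v₂(x) < 0`
(`not_mem_localKernelOfReduction_of_valuation_le_one`, Silverman VII.1.3(b): the two minimal models differ by `u ∈ ℤ₂ˣ`, `r ∈ ℤ₂`),
hence `red_v P = 0` for X2's reduction map of the global minimal model (`helper_localRed_ratPoint_eq_zero_iff`); so a `2`-power-torsion
such `P` defines an element of `C_v(E)`. [cite: SilvermanAEC2009, Prop. VII.1.3(b), VII.2.1–2.2] [cite: GreenbergLNM1716, §2 p. 70] -/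
theorem mem_plus_of_mem_localKernelOfReduction (P : W.toAffine.Point) {t : ℕ} (ht : 2 ^ t • toGeomPoints W P = 0)
    (hE : pointsMap W (v.adicCompletion ℚ) (toGeomPoints W P) ∈ W.localKernelOfReduction v) :
    (⟨toGeomPoints W P, (AddCommGroup.mem_primaryComponent).mpr ⟨t, ht⟩⟩ : W.geomPrimaryTorsion 2) ∈
      (reductionDatum W 2 hv hΔ).plus := by
  rw [mem_reductionDatum_plus_iff]
  change localRed W 2 hv hΔ (pointsMap W (v.adicCompletion ℚ) (toGeomPoints W P)) = 0
  rcases P with _ | ⟨x₀, y₀, h⟩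
  · rw [show (Affine.Point.zero : W.toAffine.Point) = 0 from rfl, map_zero, map_zero, map_zero]
  · have hx : 1 < v.valuation ℚ x₀ := lt_of_not_ge fun hle ↦
      RationalTorsionKernelOfReduction.not_mem_localKernelOfReduction_of_valuation_le_one W v h hle hE
    obtain ⟨hC, hG⟩ := DepletionAtTwo.ArchTransport.toGeomPoints_some W h
    rw [hG]
    exact (DepletionAtTwo.OddIsoTwoAdic.helper_localRed_ratPoint_eq_zero_iff W hv hΔ x₀ y₀ hC).mpr
      ((Greenberg1999.twoTorsionRamifiedAtTwo_iff x₀).mpr ((DepletionAtTwo.OddIsoTwoAdic.one_lt_valuation_iff_padicValRat_neg hv x₀).mp hx))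

omit [W.IsGloballyMinimal] [W.IsElliptic] in
/-- A rational point is `Γ_ℚ`-fixed in `E(ℚ̄)`, hence so is every element of `E[2^∞]` over it. [folklore] -/
theorem smul_eq_self_of_toGeomPoints (P : W.toAffine.Point) {t : ℕ} (ht : 2 ^ t • toGeomPoints W P = 0)
    (σ : absoluteGaloisGroup ℚ) :
    σ • (⟨toGeomPoints W P, (AddCommGroup.mem_primaryComponent).mpr ⟨t, ht⟩⟩ : W.geomPrimaryTorsion 2) =
      ⟨toGeomPoints W P, (AddCommGroup.mem_primaryComponent).mpr ⟨t, ht⟩⟩ := by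
  apply Subtype.ext
  rw [primaryComponent.coe_smul]
  exact MulAction.mem_fixedPoints.mp ((W.mem_range_toGeomPoints_iff _).mp ⟨P, rfl⟩) σ

end Dictionary

end Summit.BirchSwinnertonDyer.BirchSwinnertonDyer.Theorems.TwoAdicEulerCharKernel.IsoT1

end
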